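import Literature.MathematicalPhysics.QuantumFieldTheory.Balaban1983to89.Node00.Record10Carriers
import Literature.MathematicalPhysics.QuantumFieldTheory.Balaban1983to89.B15LeafKnitTower9

/-!
# NODE 00 (YM-PLAN Track A) — THE [Balaban1989LargeFieldI] BUNDLE `W` PINNED at Stage 10 to n12-a's knit `B15LeafKnitRepr.WOfRepr` READ AT THE
# REPRESENTED TOWER OF RECORD (`Tstep rep_k` = `reprTOfRecord₁₀`, the selector `ppSel`, the fibre bonds `fibOfSeq` — OBJECTS of the record's own
# parameters), ONE step per run; the step selector, the (1.89) point-set letters, the (1.100) data of 𝐑′ and the Proposition-1 carrier carried as ONE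
# explicit residual datum `ResidW`; the pin UP-SIDE; the cumulative record predicate `IsRecordOfRecord₁₀CB10YZW → ₁₀CB10YZ → ₁₀C`; the `rBasicStep` leaf
# at such a record IS `B15Leaf (WOfRecord₁₀ θ λ P)`, and n12-a's hook `B15LeafKnitTower9` delivers it from the DISPLAYED provisos + four printed statements

NODE 00 CARRIER MODULE, fourth pin (seat `pub-ymgap-node00-def` g30, 2026-08-26; dag-lead REBALANCE №46, pub-ymgap INBOX l.11436: the [IV] W pin is NODE 00's lane
— the n12-a lineage's own word, `HOME/HANDOFF-dag-n12-a.md` §8 (t1) «file `Record9W` ONLY on node00-def ∕ def-T's word — else hand them the recipe»; START-HERE =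
`HOME/pub-ymgap-dag-n12-a/lean/Record9W.draft.lean` (`Stage9WParams` + `kSel ∕ LF ∕ D189 ∕ D1100`, `WOfRecord₉`, `IsRecordOfRecord₉W → ₉C`), here RE-CUT in the
`CarriersB10 ∕ Y ∕ Z` pattern of `STAGE10-CARRIERS-DESIGN-g29.md` §1 (residual data a separate datum, not new parameter fields; the pin an up-side transformer;
cumulative suffix at the current machine stage ₁₀)).  APPEND-ONLY: a NEW importing module; `Record10Carriers`, def-T's `Record10`, n12-a's
`B15LeafKnitRepr ∕ B15LeafKnitTower9 ∕ B15LeafKnitRecord7`, def-R's tower ∕ R-step modules untouched and CONSUMED BY NAME.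
[Balaban1989LargeFieldI] = T. Bałaban, *Large field renormalization. I. The basic step of the 𝐑 operation*, Commun. Math. Phys. **122** (1989) 175–202 («[IV]»):
(0.2)–(0.6) p. 176, Proposition 1 (1.78) p. 194, (1.80) p. 195, (1.89) p. 198, (1.99)–(1.102) pp. 200–201.

WHAT IS PINNED.  In `Residual₅.W P : PrintedCarriers15` EVERYTHING was free data (n12-a's census `B15LeafKnitRecord7.not_forall_admissible_b15Leaf₇`: the leaf over
a residual bundle is refutable in ∀-form).  At a record of THIS module `W P` IS `WOfRecord₁₀ F N θ λ P := WOfRepr (Tstep rep_{k} of the tower OF RECORD at run P,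
couplings `gOfRecord₁₀ θ P`, step `k := λ.kSel P`) (θ.ppSel P _ (k+1)) (fibOfSeq … (k+1)) (λ.LF P) (λ.D189 P) (λ.D1100 P)` — so the (0.2) decomposition, the
(0.3) 𝐑-data (pieces `t_s = χ_{k+1}(s)·(𝐓e^A)_{k+1}(s)`, the `p–p′` selector of record, the `Z′` fibre bonds), the (0.5) exponents and `ρ_k := 𝐓ρ_k` of record
are OBJECTS (n12-a's `rstepOfSel_repTOfRecord9`: the knit's 𝐑-step IS `rep_{k+1}`; `sum_rterm_repTOfRecord9`: its `ρ_k` IS `𝐓ρ_k`).  WHAT STAYS RESIDUAL,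
EXPLICITLY (`ResidW`, one datum quantified with the record's parameters, no law assumed): (a) **the step `kSel P` the run's SINGLE-STEP [IV] bundle reads** —
`PrintedCarriers15` is ONE basic step; n12-a left the step a parameter of the hook and proposed `P.K − 1` (HANDOFF-dag-n12-a (t4)); dag-lead №46: NOT adopted
silently — the located question «which step does N12's leaf at a run read (or: should the binding's [IV] leaf be ∀ k < K)?» is for def-T's `Record11` (S)
and the n12 lineage; (b) the (1.89) point-set model's lattice ∕ configuration ∕ cube-index carriers `P₀, Cfg, ι` and letters `D189 : Setting189 …`
(intended: r11's `setting189Std …` at the record's χ's); (c) the (1.100) data `D1100 : RPrimeData (F.P P.K) (kSel P + 1) (SU N)` of 𝐑′ (def-R's ₇b objects, at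
the level the binding reads); (d) the Proposition-1 carrier `LF : B15.LFVar` ([IV] Prop. 1 p. 194 — proved only in [Balaban1989LargeFieldII] pp. 358–359).

CONSEQUENCE, SAID (pub-ymgap R433 species): at a record of this module the `rBasicStep` leaf IS `B15Leaf (WOfRecord₁₀ F N θ λ P)`
(`leaf_rBasicStep_iff_of_isRecordOfRecord₁₀CB10YZW`), whose conjuncts (0.4) ∕ (0.6) READ OBJECTS and are n12-a's theorems modulo the displayed provisos
(`B15LeafKnitTower9.integral_rop_WOfTower9_eq`, `b15Leaf_WOfTower9_of_mass`), while `p1` (Prop. 1 on `LF`), `i180` ∕ `c189` (on `D189`), `e1102` (on `D1100`) read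
the RESIDUAL letters and are CLOSABLE AND REFUTABLE BY JUNK (`not_b15Leaf_WOfRecord₁₀_swapLF`: a Proposition-1 carrier with no orbits kills `p1`) — so N12 is
NOT bookable over this predicate in ∀-form; the displayed-hypotheses form IS n12-a's hook `B15LeafKnitTower9.b15_main_of_refines₅C_WOfTower9`, instantiated
here once at the record's own parameter tuple (`b15_main_of_isRecordOfRecord₁₀CB10YZW_of_displays`).  B-5 ∕ RIDER №27 (located defect at (1.5) p. 20) untouched:
the pin types the slot, it asserts nothing.
THE PIN IS UP-SIDE and CUMULATIVE: `Stage5Params.pinW` replaces `res.W` only (datum and the `b9 ∕ b10 ∕ b11` leaves unchanged — n12-a's `datumOfRecord₅_updW` by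
name); unlike `Y ∕ Z` the bundle is a FUNCTION OF THE RECORD'S PARAMETERS `θ` (the tower), computed from the UNPINNED `θ` and applied on top of the cumulative
view `view₁₀B10YZ` (`view₁₀B10YZW`); the refinement to `IsRecordOfRecord₁₀CB10YZ` holds WITH THE SAME DATUM AND WORLD (witness `θ.pinW (WOfRecord₁₀ θ λ)`;
no machine object reads `res`, so `WOfRecord₁₀ (θ.pinW _) λ = WOfRecord₁₀ θ λ` — `WOfRecord₁₀_pinW`, `rfl`); inhabitation = `IsRecordOfRecord₁₀C`'s.
HONEST FRAMING: definitions + kernel bookkeeping; NO estimate; nothing of [IV] asserted; N12 NOT discharged; counts unmoved; one finite T⁴ programme at fixed ε —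
NOT continuum ∕ ℝ⁴ ∕ infinite volume ∕ OS ∕ mass gap ∕ Clay.  No `sorry`, no `axiom`, no `opaque`, no `instance`, no `notation`. -/

noncomputable section

open MeasureTheory

namespace Literature.MathematicalPhysics.QuantumFieldTheory.Balaban1983to89.Node00

open T4Continuum AveragingRT T4FiniteEpsInhabited FlowStep FlowStepRuns DagBinding T4DatumAssembly
open B15LeafKnitRepr (WOfRepr)
open B15Claim189Assembly (Setting189 new189 chiPP dom)
open B15Sect1Statements (RPrimeData Normalization1102)
open B15 (Prop1Printed Ineq180)
open B15.BasicStep (Claim189)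
open B8Eq17ClassAkV1 (plaqsOf)
open scoped Matrix.Norms.L2Operator

/-! ## §1. The residual layer of the [IV] group, the bundle of record at `(θ, λ, P)`, what its leaf reads -/

section Bundle

variable (F : T4Family) (N : ℕ) [NeZero N]

/-- **THE RESIDUAL LAYER of the [IV] group at NODE 00's objects** (data, no law): per run the STEP the single-step bundle reads, the (1.89) point-set model's
carriers and letters, the (1.100) data of 𝐑′ at that step, and the Proposition-1 carrier. [cite: Balaban1989LargeFieldI, Prop. 1 p.194, (1.89) p.198, (1.100) p.201 (the data the typed statements read)] -/
structure ResidW where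
  /-- THE step `k` per run: the bundle is [IV]'s basic step `ρ_k ↦ 𝐑𝐓ρ_k` read at `Tstep rep_k` (located question; no default adopted) -/
  kSel : B12.RunParams → ℕ
  /-- lattice parameters of the (1.89) point-set model, per run -/
  P₀ : B12.RunParams → Params
  /-- its configuration carrier, per run -/
  Cfg : B12.RunParams → Type
  /-- its cube-index carrier, per run -/
  ι : B12.RunParams → Type
  /-- RESIDUAL: the Proposition-1 carrier of [IV] p.194, per run -/
  LF : B12.RunParams → B15.LFVar
  /-- RESIDUAL: the (1.89) letters, per run -/
  D189 : (P : B12.RunParams) → Setting189 (P₀ P) (SU N) (Cfg P) (ι P)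
  /-- RESIDUAL: the (1.100) data of 𝐑′ at level `kSel P + 1`, per run -/
  D1100 : (P : B12.RunParams) → RPrimeData (F.P P.K) (kSel P + 1) (SU N)

/-- **THE [IV] CARRIER BUNDLE OF RECORD at `(θ, λ)`, run `P`**: n12-a's `WOfRepr` read at the pre-𝐑 representation `Tstep rep_k` OF THE TOWER OF RECORD at Stage 10
(`repTOfRecord9` at the plugs `EOfRecord₁₀ θ`, `wOfRecord₉ θ`, `θ.ppSel`, couplings `gOfRecord₁₀ θ P` — i.e. `reprTOfRecord₁₀ θ P k`, `WOfRecord₁₀_eq`), step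
`k := λ.kSel P`, the selector of record at level `k+1`, the fibre bonds `fibOfSeq … (k+1)`, and the residual letters `LF ∕ D189 ∕ D1100`; bond equality = the
record cone's global `instDecidableEqPBond` (as `Record5`–`Record10`; n12-a's junction identities `rstepOfSel_repTOfRecord9` ∕ `sum_rterm_repTOfRecord9`, stated at definer ₇'s
classical instance, transfer by `Subsingleton.elim` on the instance — TS-8). [cite: Balaban1989LargeFieldI, (0.2)–(0.6) p.176, Prop. 1 p.194, (1.89) p.198, (1.100)–(1.102) p.201 (dictionary of the pin)] -/
def WOfRecord₁₀ (θ : Stage9Params F N) (lam : ResidW F N) (P : B12.RunParams) : PrintedCarriers15 :=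
  WOfRepr (repTOfRecord9 F N θ.ν θ.τ9 (EOfRecord₁₀ F N θ) (wOfRecord₉ F N θ) θ.ppSel P (gOfRecord₁₀ F N θ P) (lam.kSel P))
    (θ.ppSel P (gOfRecord₁₀ F N θ P) (lam.kSel P + 1)) (fibOfSeq F θ.ν θ.τ9 P (gOfRecord₁₀ F N θ P) (lam.kSel P + 1))
    (lam.LF P) (lam.D189 P) (lam.D1100 P)

/-- The pre-𝐑 representation the bundle reads IS def-T's `reprTOfRecord₁₀ θ P k` (`rfl`). [cite: Balaban1988Convergent, (3.25) p.270 (bookkeeping)] -/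
theorem WOfRecord₁₀_eq (θ : Stage9Params F N) (lam : ResidW F N) (P : B12.RunParams) :
    WOfRecord₁₀ F N θ lam P =
      WOfRepr (reprTOfRecord₁₀ F N θ P (lam.kSel P)) (θ.ppSel P (gOfRecord₁₀ F N θ P) (lam.kSel P + 1))
        (fibOfSeq F θ.ν θ.τ9 P (gOfRecord₁₀ F N θ P) (lam.kSel P + 1)) (lam.LF P) (lam.D189 P) (lam.D1100 P) := rfl

/-- The bundle's Proposition-1 carrier IS the residual `LF P` (`rfl`; n12-a's `WOfTower9_LF`). [cite: Balaban1989LargeFieldI, Prop. 1 p.194 (bookkeeping)] -/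
theorem WOfRecord₁₀_LF (θ : Stage9Params F N) (lam : ResidW F N) (P : B12.RunParams) : (WOfRecord₁₀ F N θ lam P).LF = lam.LF P := rfl

variable {F N}

/-- **THE ∀-FORM IS JUNK-REFUTABLE THROUGH THE RESIDUAL LETTERS** (R433 species, kernel form): swapping ANY residual layer's Proposition-1 carrier for one with an
inhabited boundary datum, `Regular ≡ ⊤` and NO orbits makes the leaf FAIL at every run (Prop. 1 would produce a critical orbit).  So a pin of `LF` (and of `D189`,
`D1100`) by objects must precede any ∀-form booking of N12. [cite: Balaban1989LargeFieldI, Prop. 1 (1.78) p.194 (bookkeeping: the typed conjunct reads the residual carrier)] -/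
theorem not_b15Leaf_WOfRecord₁₀_swapLF (θ : Stage9Params F N) (lam : ResidW F N) (P : B12.RunParams) :
    ¬ B15Leaf (WOfRecord₁₀ F N θ
      { lam with LF := fun _ => ⟨PUnit, fun _ => 0, fun _ => PUnit, fun _ => PEmpty, fun _ _ _ => True, fun _ _ o => o.elim, fun _ _ o => o.elim,
        fun _ o => o.elim, fun _ _ _ => True⟩ } P) := by
  intro h
  obtain ⟨B₅, -, hall⟩ := h.p1
  obtain ⟨e0, he0, he⟩ := hall PUnit.unit
  obtain ⟨O, -⟩ := he e0 he0 le_rfl PUnit.unit trivial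
  exact O.elim

end Bundle

/-! ## §2. The pin on Stage-5 parameters (UP-SIDE) -/

section Pin

variable (F : T4Family) (N : ℕ) [NeZero N]

/-- **The W pin of a Stage-5 residual**: the run-indexed [IV] bundle := `W₀`; every other field unchanged. [cite: Balaban1989LargeFieldI, (0.2)–(0.6) p.176 (the objects the leaf `rBasicStep` reads)] -/
def Residual₅.pinW (r : Residual₅ F N) (W₀ : B12.RunParams → PrintedCarriers15) : Residual₅ F N :=
  { r with W := W₀ }

/-- **The W pin of Stage-5 parameters**. [cite: Balaban1989LargeFieldI, (0.2) p.176 (objects of record)] -/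
def Stage5Params.pinW (θ : Stage5Params F N) (W₀ : B12.RunParams → PrintedCarriers15) : Stage5Params F N := { θ with res := θ.res.pinW F N W₀ }

/-- The pin touches neither admissibility (`Iff.rfl`) … [cite: Balaban1983RegularityDecay, (1.6) p.572 (hypothesis dictionary; bookkeeping)] -/
theorem Stage5Params.pinW_admissible_iff (θ : Stage5Params F N) (W₀ : B12.RunParams → PrintedCarriers15) : (θ.pinW F N W₀).Admissible ↔ θ.Admissible :=
  Iff.rfl

/-- … nor the assembled datum: THE PIN IS UP-SIDE (n12-a's `B15LeafKnitRecord7.datumOfRecord₅_updW` BY NAME). [cite: Balaban1988Convergent, (0.2) p.244 (bookkeeping)] -/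
theorem datumOfRecord₅_pinW (θ : Stage5Params F N) (W₀ : B12.RunParams → PrintedCarriers15) : datumOfRecord₅ F N (θ.pinW F N W₀) = datumOfRecord₅ F N θ :=
  B15LeafKnitRecord7.datumOfRecord₅_updW θ W₀

/-- **The `rBasicStep` leaf of the C-binding at W-pinned parameters IS `B15Leaf (W₀ P)`** (`Iff.rfl`). [cite: Balaban1989LargeFieldI, Prop. 1 p.194, (0.4)–(0.6) p.176 (the leaf `B15Leaf`)] -/
theorem upOfRecord₅C_pinW_rBasicStep_iff (θ : Stage5Params F N) (W₀ : B12.RunParams → PrintedCarriers15) (P : B12.RunParams) :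
    (upOfRecord₅C F N (θ.pinW F N W₀) P).rBasicStep ↔ B15Leaf (W₀ P) := Iff.rfl

/-- The `b9`, `b10`, `b11` leaves are unchanged by the W pin (`rfl` ×3) — the [B9] ∕ [B10] ∕ [B11] pins' faces survive. [cite: Balaban1985UV3, Thm 1 p.257; Balaban1985BackgroundPropagators, Thm 3.1 p.397; Balaban1985Variational, Thm 1 p.279 (bookkeeping)] -/
theorem upOfRecord₅C_pinW_b9_b10_b11 (θ : Stage5Params F N) (W₀ : B12.RunParams → PrintedCarriers15) (P : B12.RunParams) :
    (upOfRecord₅C F N (θ.pinW F N W₀) P).b9 = (upOfRecord₅C F N θ P).b9 ∧ (upOfRecord₅C F N (θ.pinW F N W₀) P).b10 = (upOfRecord₅C F N θ P).b10 ∧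
      (upOfRecord₅C F N (θ.pinW F N W₀) P).b11 = (upOfRecord₅C F N θ P).b11 :=
  ⟨rfl, rfl, rfl⟩

end Pin

/-! ## §3. The cumulative Stage-10 record with the [B10], [B9], [B11] AND [IV] groups pinned: `IsRecordOfRecord₁₀CB10YZW` -/

section Record10

variable (F : T4Family) (N : ℕ) [NeZero N]

/-- The W pin of Stage-9 parameters. [cite: Balaban1989LargeFieldI, (0.2) p.176 (bookkeeping)] -/
def Stage9Params.pinW (θ : Stage9Params F N) (W₀ : B12.RunParams → PrintedCarriers15) : Stage9Params F N := { θ with res := θ.res.pinW F N W₀ }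

/-- Admissibility is unchanged (`Iff.rfl`). [cite: Balaban1987RG1, (1.20)–(1.21) p.264 (hypothesis dictionary; bookkeeping)] -/
theorem Stage9Params.pinW_admissible_iff (θ : Stage9Params F N) (W₀ : B12.RunParams → PrintedCarriers15) : (θ.pinW F N W₀).Admissible ↔ θ.Admissible :=
  Iff.rfl

/-- The Stage-10 view of W-pinned parameters IS the W-pinned Stage-10 view (`rfl`: `residualOfStage10` keeps `W`). [cite: Balaban1988Convergent, p.244 (bookkeeping)] -/
theorem Stage9Params.toStage5₁₀_pinW (θ : Stage9Params F N) (W₀ : B12.RunParams → PrintedCarriers15) :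
    (θ.pinW F N W₀).toStage5₁₀ F N = (θ.toStage5₁₀ F N).pinW F N W₀ := rfl

/-- **The bundle of record does not read the pinned field**: `WOfRecord₁₀ (θ.pinW W₀) λ = WOfRecord₁₀ θ λ` (`rfl`: the tower, the selector, the couplings and
the fibre bonds read `θ`'s numerics ∕ residual operators, never `res.W`). [cite: Balaban1988Convergent, (2.18) p.257, (3.25) p.270 (bookkeeping)] -/
theorem WOfRecord₁₀_pinW (θ : Stage9Params F N) (W₀ : B12.RunParams → PrintedCarriers15) (lam : ResidW F N) :
    WOfRecord₁₀ F N (θ.pinW F N W₀) lam = WOfRecord₁₀ F N θ lam := rfl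

variable {F N} in
/-- The Stage-10 provisos (incl. `contT`) transport along the W pin, field by field … [cite: Balaban1988Convergent, (3.2)–(3.9) pp.265–266; Balaban1987RG1, (0.19) p.255 (bookkeeping)] -/
theorem Stage9Params.Provisos₁₀.pinW {θ : Stage9Params F N} (h : θ.Provisos₁₀) (W₀ : B12.RunParams → PrintedCarriers15) : (θ.pinW F N W₀).Provisos₁₀ :=
  ⟨h.intPiece, h.measω, h.measChi, h.zetaUnity, h.zetaAbs, fun p k _ hk => h.rstep p k hk, h.contT⟩

variable {F N} in
/-- … and back. [cite: Balaban1988Convergent, (3.2)–(3.9) pp.265–266 (bookkeeping)] -/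
theorem Stage9Params.Provisos₁₀.of_pinW {θ : Stage9Params F N} {W₀ : B12.RunParams → PrintedCarriers15} (h : (θ.pinW F N W₀).Provisos₁₀) : θ.Provisos₁₀ :=
  ⟨h.intPiece, h.measω, h.measChi, h.zetaUnity, h.zetaAbs, fun p k _ hk => h.rstep p k hk, h.contT⟩

/-- THE PIN IS UP-SIDE at Stage 10: the datum of record is unchanged (`rfl`). [cite: Balaban1989LargeFieldII, Thm 1 + (0.1) pp.355–356 (bookkeeping)] -/
theorem datumOfRecord₁₀_pinW (θ : Stage9Params F N) (h : θ.Provisos₁₀) (W₀ : B12.RunParams → PrintedCarriers15) :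
    datumOfRecord₁₀ F N (θ.pinW F N W₀) (h.pinW W₀) = datumOfRecord₁₀ F N θ h := rfl

/-- **The cumulative pinned Stage-10 view with W**: `view₁₀B10YZ θ Mstar ops ζ` pinned further by `pinW (WOfRecord₁₀ θ λ)` — the bundle computed from the
record's OWN parameters. [cite: Balaban1989LargeFieldI, (0.2)–(0.6) p.176 (objects of record)] -/
def Stage9Params.view₁₀B10YZW (θ : Stage9Params F N) (Mstar : ℕ) (ops : OpsY N θ.toStage3Params Mstar) (ζ : ResidZ F N) (lam : ResidW F N) :
    Stage5Params F N :=
  (θ.view₁₀B10YZ F N Mstar ops ζ).pinW F N (WOfRecord₁₀ F N θ lam)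

/-- The cumulative view with W IS the `view₁₀B10YZ` of the W-PINNED parameters (composed from the single-pin `rfl`s: the pins commute, `toStage5₁₀` passes
`pinW` through, the bundle does not read the pinned field). [cite: Balaban1989LargeFieldI, (0.2) p.176 (bookkeeping)] -/
theorem Stage9Params.view₁₀B10YZW_eq (θ : Stage9Params F N) (Mstar : ℕ) (ops : OpsY N θ.toStage3Params Mstar) (ζ : ResidZ F N) (lam : ResidW F N) :
    θ.view₁₀B10YZW F N Mstar ops ζ lam = (θ.pinW F N (WOfRecord₁₀ F N θ lam)).view₁₀B10YZ F N Mstar ops ζ := by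
  unfold Stage9Params.view₁₀B10YZW Stage9Params.view₁₀B10YZ
  rw [Stage9Params.toStage5₁₀_pinW]
  rfl

/-- The leaves of the C-binding over the cumulative view with W, by name: `rBasicStep ↔ B15Leaf (WOfRecord₁₀ θ λ P)`, and the three earlier faces survive.
[cite: Balaban1989LargeFieldI, Prop. 1 p.194, (0.4)–(0.6) p.176; Balaban1985Variational, Thm 1 p.279; Balaban1985BackgroundPropagators, Thm 3.1 p.397; Balaban1985UV3, Thm 1 p.257] -/
theorem upOfRecord₅C_view₁₀B10YZW_leaves (θ : Stage9Params F N) (Mstar : ℕ) (ops : OpsY N θ.toStage3Params Mstar) (ζ : ResidZ F N) (lam : ResidW F N)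
    (P : B12.RunParams) :
    ((upOfRecord₅C F N (θ.view₁₀B10YZW F N Mstar ops ζ lam) P).rBasicStep ↔ B15Leaf (WOfRecord₁₀ F N θ lam P)) ∧
    ((upOfRecord₅C F N (θ.view₁₀B10YZW F N Mstar ops ζ lam) P).b9 ↔ B9LeafX (Y9OfRecord N θ.toStage3Params Mstar ops)) ∧
    ((upOfRecord₅C F N (θ.view₁₀B10YZW F N Mstar ops ζ lam) P).b10 ↔ PrintedUV3V N θ.L) ∧
    ((upOfRecord₅C F N (θ.view₁₀B10YZW F N Mstar ops ζ lam) P).b11 ↔ B11Leaf (Z11OfRecord F N ζ)) := by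
  have hl := upOfRecord₅C_view₁₀B10YZ_leaves F N θ Mstar ops ζ P
  have hw := upOfRecord₅C_pinW_b9_b10_b11 F N (θ.view₁₀B10YZ F N Mstar ops ζ) (WOfRecord₁₀ F N θ lam) P
  refine ⟨upOfRecord₅C_pinW_rBasicStep_iff F N _ _ P, ?_, ?_, ?_⟩
  · unfold Stage9Params.view₁₀B10YZW
    rw [hw.1]; exact hl.2.1
  · unfold Stage9Params.view₁₀B10YZW
    rw [hw.2.1]; exact hl.2.2
  · unfold Stage9Params.view₁₀B10YZW
    rw [hw.2.2]; exact hl.1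

/-- **«(D, w) is the record, Stage 10, [B10], [B9], [B11] and [IV] groups pinned»** (CUMULATIVE): `IsRecordOfRecord₁₀CB10YZ` VERBATIM except that the upstream block
is the C-binding at `view₁₀B10YZW θ Mstar ops ζ λ` for SOME residual [IV] layer `λ` (quantified with the record's parameters; no law assumed).
[cite: Balaban1989LargeFieldI, (0.2)–(0.6) p.176, Prop. 1 p.194, (1.89) p.198, (1.102) p.201; Balaban1989LargeFieldII, Thm 1 + (0.1) pp.355–356 (objects of record)] -/
def IsRecordOfRecord₁₀CB10YZW (D : FiniteEpsData F (SU N)) (w : WorldP) : Prop :=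
  ∃ (θ : Stage9Params F N) (h : θ.Provisos₁₀) (Mstar : ℕ) (ops : OpsY N θ.toStage3Params Mstar) (ζ : ResidZ F N) (lam : ResidW F N),
    θ.Admissible ∧ D = datumOfRecord₁₀ F N θ h ∧ w.C = D.C ∧ (0 < w.γ ∧ w.γ ≤ θ.γ) ∧ w.L = (θ.L : ℝ) ∧
      ∀ P : B12.RunParams, w.up P = upOfRecord₅C F N (θ.view₁₀B10YZW F N Mstar ops ζ lam) P

/-- Pointed form. [cite: Balaban1989LargeFieldII, Thm 1 + (0.1) pp.355–356 (bookkeeping)] -/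
theorem isRecordOfRecord₁₀CB10YZW_of_eq (θ : Stage9Params F N) (h : θ.Provisos₁₀) (hθ : θ.Admissible) (Mstar : ℕ) (ops : OpsY N θ.toStage3Params Mstar)
    (ζ : ResidZ F N) (lam : ResidW F N) (w : WorldP) (hC : w.C = (datumOfRecord₁₀ F N θ h).C) (hγ : 0 < w.γ ∧ w.γ ≤ θ.γ) (hL : w.L = (θ.L : ℝ))
    (hup : ∀ P, w.up P = upOfRecord₅C F N (θ.view₁₀B10YZW F N Mstar ops ζ lam) P) :
    IsRecordOfRecord₁₀CB10YZW F N (datumOfRecord₁₀ F N θ h) w :=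
  ⟨θ, h, Mstar, ops, ζ, lam, hθ, rfl, hC, hγ, hL, hup⟩

/-- **Inhabitation is Stage 10's EXACTLY**: every admissible Stage-9 parameter with its Stage-10 provisos, ANY floor, operator layer, [B11] layer and [IV] layer give
a record of this module at some world, any window `0 < γw ≤ θ.γ`. [cite: Balaban1989LargeFieldII, Thm 1 + (0.1) pp.355–356 (bookkeeping)] -/
theorem exists_world_isRecordOfRecord₁₀CB10YZW (θ : Stage9Params F N) (h : θ.Provisos₁₀) (hθ : θ.Admissible) (Mstar : ℕ)
    (ops : OpsY N θ.toStage3Params Mstar) (ζ : ResidZ F N) (lam : ResidW F N) {γw : ℝ} (hγw : 0 < γw ∧ γw ≤ θ.γ) :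
    ∃ w : WorldP, IsRecordOfRecord₁₀CB10YZW F N (datumOfRecord₁₀ F N θ h) w ∧ w.γ = γw := by
  obtain ⟨w₀, -, -⟩ := exists_world_isRecordOfRecord₁₀C F N θ h hθ hγw
  exact ⟨{ w₀ with
      C := (datumOfRecord₁₀ F N θ h).C, γ := γw, L := (θ.L : ℝ), one_lt_L := by exact_mod_cast θ.hL.2,
      up := fun P => upOfRecord₅C F N (θ.view₁₀B10YZW F N Mstar ops ζ lam) P },
    ⟨θ, h, Mstar, ops, ζ, lam, hθ, rfl, rfl, hγw, rfl, fun _ => rfl⟩, rfl⟩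

variable {F N}
variable {D : FiniteEpsData F (SU N)} {w : WorldP}

/-- **Refinement `IsRecordOfRecord₁₀CB10YZW → IsRecordOfRecord₁₀CB10YZ`** with THE SAME datum AND world: witness `θ.pinW (WOfRecord₁₀ θ λ)` (provisos transported, datum
`rfl`, view `view₁₀B10YZW_eq`). [cite: Balaban1989LargeFieldII, Thm 1 + (0.1) pp.355–356 (bookkeeping)] -/
theorem isRecordOfRecord₁₀CB10YZ_of_isRecordOfRecord₁₀CB10YZW (h : IsRecordOfRecord₁₀CB10YZW F N D w) : IsRecordOfRecord₁₀CB10YZ F N D w := by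
  obtain ⟨θ, hP, Mstar, ops, ζ, lam, hθ, hD, hC, hγ, hL, hup⟩ := h
  refine ⟨θ.pinW F N (WOfRecord₁₀ F N θ lam), hP.pinW _, Mstar, ops, ζ, hθ, ?_, hC, hγ, hL, fun P => ?_⟩
  · rw [datumOfRecord₁₀_pinW F N θ hP]; exact hD
  · rw [hup P, Stage9Params.view₁₀B10YZW_eq]

/-- … hence to `IsRecordOfRecord₁₀C`. [cite: Balaban1989LargeFieldII, Thm 1 p.355 (bookkeeping)] -/
theorem isRecordOfRecord₁₀C_of_isRecordOfRecord₁₀CB10YZW (h : IsRecordOfRecord₁₀CB10YZW F N D w) : IsRecordOfRecord₁₀C F N D w :=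
  isRecordOfRecord₁₀C_of_isRecordOfRecord₁₀CB10YZ (isRecordOfRecord₁₀CB10YZ_of_isRecordOfRecord₁₀CB10YZW h)

/-- The `atWorld` transfer: every world-reading node theorem over `IsRecordOfRecord₅C` holds at every record of this module. [cite: Balaban1989LargeFieldII, Thm 1 p.355 (bookkeeping)] -/
theorem atWorld_of_isRecordOfRecord₁₀CB10YZW {X : Dag.Leaves → Prop}
    (h₅ : ∀ (D : FiniteEpsData F (SU N)) (w : WorldP), IsRecordOfRecord₅C F N D w → ∀ P : B12.RunParams, X (leavesP w P))
    (h : IsRecordOfRecord₁₀CB10YZW F N D w) (P : B12.RunParams) : X (leavesP w P) :=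
  atWorld_of_isRecordOfRecord₁₀C h₅ (isRecordOfRecord₁₀C_of_isRecordOfRecord₁₀CB10YZW h) P

/-- **THE FOUR PINNED LEAVES AT A RECORD OF THIS MODULE, for ONE parameter package**: `rBasicStep ↔ B15Leaf (WOfRecord₁₀ θ λ P)`, `b9 ↔` def-Y's leaf at `Y9OfRecord`,
`b10 ↔ PrintedUV3V N θ.L`, `b11 ↔ B11Leaf (Z11OfRecord F N ζ)`. [cite: Balaban1989LargeFieldI, Prop. 1 p.194; Balaban1985Variational, Thm 1 p.279; Balaban1985BackgroundPropagators, Thm 3.1 p.397; Balaban1985UV3, Thm 1 p.257] -/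
theorem leaves_iff_of_isRecordOfRecord₁₀CB10YZW (h : IsRecordOfRecord₁₀CB10YZW F N D w) :
    ∃ (θ : Stage9Params F N) (Mstar : ℕ) (ops : OpsY N θ.toStage3Params Mstar) (ζ : ResidZ F N) (lam : ResidW F N), θ.Admissible ∧ w.L = (θ.L : ℝ) ∧
      ∀ P : B12.RunParams,
        ((leavesP w P).rBasicStep ↔ B15Leaf (WOfRecord₁₀ F N θ lam P)) ∧ ((leavesP w P).b9 ↔ B9LeafX (Y9OfRecord N θ.toStage3Params Mstar ops)) ∧
        ((leavesP w P).b10 ↔ PrintedUV3V N θ.L) ∧ ((leavesP w P).b11 ↔ B11Leaf (Z11OfRecord F N ζ)) := by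
  obtain ⟨θ, -, Mstar, ops, ζ, lam, hθ, -, -, -, hL, hup⟩ := h
  refine ⟨θ, Mstar, ops, ζ, lam, hθ, hL, fun P => ?_⟩
  have hl := upOfRecord₅C_view₁₀B10YZW_leaves F N θ Mstar ops ζ lam P
  refine ⟨?_, ?_, ?_, ?_⟩
  · show (w.up P).rBasicStep ↔ _
    rw [hup P]; exact hl.1
  · show (w.up P).b9 ↔ _
    rw [hup P]; exact hl.2.1
  · show (w.up P).b10 ↔ _
    rw [hup P]; exact hl.2.2.1
  · show (w.up P).b11 ↔ _
    rw [hup P]; exact hl.2.2.2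

/-- **THE `rBasicStep` LEAF AT A RECORD OF THIS MODULE IS THE [IV] LEAF AT THE BUNDLE OF RECORD** (the N12 socket n12-a's REACTIVATE №8 keys its closers to).
[cite: Balaban1989LargeFieldI, Prop. 1 p.194, (0.4)–(0.6) p.176, (1.89) p.198, (1.102) p.201] -/
theorem leaf_rBasicStep_iff_of_isRecordOfRecord₁₀CB10YZW (h : IsRecordOfRecord₁₀CB10YZW F N D w) :
    ∃ (θ : Stage9Params F N) (lam : ResidW F N), θ.Admissible ∧ ∀ P : B12.RunParams, (leavesP w P).rBasicStep ↔ B15Leaf (WOfRecord₁₀ F N θ lam P) := by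
  obtain ⟨θ, Mstar, ops, ζ, lam, hθ, -, hl⟩ := leaves_iff_of_isRecordOfRecord₁₀CB10YZW h
  exact ⟨θ, lam, hθ, fun P => (hl P).1⟩

/-- **N12 «SLOTS» FORM at a record of this module**: if for every parameter package presenting `(D, w)` as a record of this module the [IV] leaf holds at the bundle of
record at every run, then `Dag.B15_main` holds at every run (in-edges unused).  The hypothesis quantifies over the HIDDEN residual layers — honest, and why N12 is not
bookable in ∀-form here (`not_b15Leaf_WOfRecord₁₀_swapLF`). [cite: Balaban1989LargeFieldI, Prop. 1 p.194, (0.2)–(0.6) p.176 (the node's shape `Dag.B15_main`, bookkeeping)] -/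
theorem b15_main_of_isRecordOfRecord₁₀CB10YZW_of_slots (h : IsRecordOfRecord₁₀CB10YZW F N D w)
    (hW : ∀ (θ : Stage9Params F N) (hP : θ.Provisos₁₀) (Mstar : ℕ) (ops : OpsY N θ.toStage3Params Mstar) (ζ : ResidZ F N) (lam : ResidW F N), θ.Admissible →
      D = datumOfRecord₁₀ F N θ hP → (∀ P, w.up P = upOfRecord₅C F N (θ.view₁₀B10YZW F N Mstar ops ζ lam) P) →
        ∀ P : B12.RunParams, B15Leaf (WOfRecord₁₀ F N θ lam P))
    (P : B12.RunParams) : Dag.B15_main (leavesP w P) := by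
  obtain ⟨θ, hP, Mstar, ops, ζ, lam, hθ, hD, -, -, -, hup⟩ := h
  intro _ _ _ _ _
  show (w.up P).rBasicStep
  rw [hup P]
  exact (upOfRecord₅C_pinW_rBasicStep_iff F N _ _ P).2 (hW θ hP Mstar ops ζ lam hθ hD hup P)

/-- **THE DISPLAYED HYPOTHESES of N12 at the bundle of record** at `(θ, λ, P)` — EXACTLY the eight premises of n12-a's hook `B15LeafKnitTower9.b15_main_of_refines₅C_WOfTower9`
read at the record's parameter tuple: the pre-𝐑 terms `t_s` of `Tstep rep_k` measurable ∕ nonnegative ∕ uniformly bounded ∕ of positive mass (p.176 ll.14–16 in the (R-C2)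
reading), and the four PRINTED statements Proposition 1 (1.78) on `λ.LF P`, (1.80) on the ℍ-domains of `λ.D189 P`, (1.89), (1.102) for `λ.D1100 P` at `𝐓ρ_k` of record
— never asserted, a structure a closer must SUPPLY. [cite: Balaban1989LargeFieldI, (0.2)–(0.6) p.176, Prop. 1 (1.78) p.194, (1.80) p.195, (1.89) p.198, (1.102) p.201] -/
structure WDisplays₁₀ (θ : Stage9Params F N) (lam : ResidW F N) (P : B12.RunParams) : Prop where
  /-- the pre-𝐑 terms are measurable -/
  hm : ∀ s, Measurable (rterm (repTOfRecord9 F N θ.ν θ.τ9 (EOfRecord₁₀ F N θ) (wOfRecord₉ F N θ) θ.ppSel P (gOfRecord₁₀ F N θ P) (lam.kSel P)) s)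
  /-- … nonnegative -/
  h0 : ∀ s V, 0 ≤ rterm (repTOfRecord9 F N θ.ν θ.τ9 (EOfRecord₁₀ F N θ) (wOfRecord₉ F N θ) θ.ppSel P (gOfRecord₁₀ F N θ P) (lam.kSel P)) s V
  /-- … uniformly bounded -/
  hC : ∃ Cρ : ℝ, ∀ s V, rterm (repTOfRecord9 F N θ.ν θ.τ9 (EOfRecord₁₀ F N θ) (wOfRecord₉ F N θ) θ.ppSel P (gOfRecord₁₀ F N θ P) (lam.kSel P)) s V ≤ Cρ
  /-- … and of positive mass -/
  hmass : ∀ s, 0 < ∫ V, rterm (repTOfRecord9 F N θ.ν θ.τ9 (EOfRecord₁₀ F N θ) (wOfRecord₉ F N θ) θ.ppSel P (gOfRecord₁₀ F N θ P) (lam.kSel P)) s V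
    ∂(fieldMeasure (F.P P.K) (lam.kSel P + 1) (SU N))
  /-- [IV] Proposition 1 (1.78) on the residual carrier -/
  hP1 : Prop1Printed (lam.LF P)
  /-- [IV] (1.80) on the ℍ-domains of the residual (1.89) letters -/
  h180 : ∀ U, new189 (lam.D189 P) U → ∀ i, (lam.D189 P).h ≤ i → i ≤ (lam.D189 P).k → ∀ q ∈ plaqsOf (dom (lam.D189 P) i),
    Ineq180 ((lam.D189 P).dev0 U q) ((lam.D189 P).ε (lam.D189 P).k) (lam.D189 P).η (lam.D189 P).B₃ (lam.D189 P).B₅ (lam.D189 P).M (lam.D189 P).δ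
      ((lam.D189 P).dist q) (lam.D189 P).O1
  /-- [IV] (1.89) -/
  h189 : Claim189 (new189 (lam.D189 P)) (chiPP (lam.D189 P))
  /-- [IV] (1.102) for the residual 𝐑′-data at `𝐓ρ_k` of record -/
  h1102 : Normalization1102 (lam.D1100 P) (trhoOfRecord9 F N θ.ν θ.τ9 (EOfRecord₁₀ F N θ) (wOfRecord₉ F N θ) θ.ppSel P (gOfRecord₁₀ F N θ P) (lam.kSel P))

/-- **The [IV] leaf at the bundle of record FROM THE DISPLAYS** (n12-a's `B15LeafKnitTower9.b15Leaf_WOfTower9_of_mass` BY NAME at the record's plugs; (0.4) and (0.6) are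
PROVED there, the four printed statements displayed). [cite: Balaban1989LargeFieldI, (0.2)–(0.6) p.176, Prop. 1 (1.78) p.194, (1.80) p.195, (1.89) p.198, (1.102) p.201] -/
theorem b15Leaf_WOfRecord₁₀_of_displays {θ : Stage9Params F N} {lam : ResidW F N} {P : B12.RunParams} (hd : WDisplays₁₀ θ lam P) :
    B15Leaf (WOfRecord₁₀ F N θ lam P) := by
  obtain ⟨Cρ, hCρ⟩ := hd.hC
  exact B15LeafKnitTower9.b15Leaf_WOfTower9_of_mass θ.ν θ.τ9 (EOfRecord₁₀ F N θ) (wOfRecord₉ F N θ) θ.ppSel P (gOfRecord₁₀ F N θ P) (lam.kSel P)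
    (lam.LF P) (lam.D189 P) (lam.D1100 P) hd.hm hd.h0 hCρ hd.hmass hd.hP1 hd.h180 hd.h189 hd.h1102

/-- **N12 OF RECORD at a record of this module, DISPLAYED-HYPOTHESES FORM** (n12-a's hook `B15LeafKnitTower9.b15_main_of_refines₅C_WOfTower9`, instantiated ONCE at the record's
own parameter tuple via the slots form): if every parameter package presenting `(D, w)` supplies the displays at every run, then `Dag.B15_main` holds at every run —
the discharge SHAPE of N12 at Stage 10 modulo [IV]'s printed estimates; NOT a discharge. [cite: Balaban1989LargeFieldI, Prop. 1 (1.78) p.194, (0.2)–(0.6) p.176, (1.80) p.195, (1.89) p.198, (1.102) p.201] -/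
theorem b15_main_of_isRecordOfRecord₁₀CB10YZW_of_displays (h : IsRecordOfRecord₁₀CB10YZW F N D w)
    (hdisp : ∀ (θ : Stage9Params F N) (hP : θ.Provisos₁₀) (Mstar : ℕ) (ops : OpsY N θ.toStage3Params Mstar) (ζ : ResidZ F N) (lam : ResidW F N), θ.Admissible →
      D = datumOfRecord₁₀ F N θ hP → (∀ P, w.up P = upOfRecord₅C F N (θ.view₁₀B10YZW F N Mstar ops ζ lam) P) → ∀ P : B12.RunParams, WDisplays₁₀ θ lam P)
    (P : B12.RunParams) : Dag.B15_main (leavesP w P) :=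
  b15_main_of_isRecordOfRecord₁₀CB10YZW_of_slots h (fun θ hP Mstar ops ζ lam hθ hD hup P => b15Leaf_WOfRecord₁₀_of_displays (hdisp θ hP Mstar ops ζ lam hθ hD hup P)) P

/-- Conversely, RE-BINDING a `₁₀C` record's world by the cumulative view with W (any floor, operator layer, [B11] layer, [IV] layer) gives a record of this module with the
SAME datum (v1.1). [cite: Balaban1989LargeFieldII, Thm 1 p.355 (bookkeeping)] -/
theorem isRecordOfRecord₁₀CB10YZW_rebind_of_isRecordOfRecord₁₀C (h : IsRecordOfRecord₁₀C F N D w) :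
    ∃ (θ : Stage9Params F N) (_ : θ.Provisos₁₀), θ.Admissible ∧ (∀ P, w.up P = upOfRecord₅C F N (θ.toStage5₁₀ F N) P) ∧
      ∀ (Mstar : ℕ) (ops : OpsY N θ.toStage3Params Mstar) (ζ : ResidZ F N) (lam : ResidW F N),
        IsRecordOfRecord₁₀CB10YZW F N D { w with up := fun P => upOfRecord₅C F N (θ.view₁₀B10YZW F N Mstar ops ζ lam) P } := by
  obtain ⟨θ, hP, hθ, hD, hC, hγ, hL, hup⟩ := h
  exact ⟨θ, hP, hθ, hup, fun Mstar ops ζ lam => ⟨θ, hP, Mstar, ops, ζ, lam, hθ, hD, hC, hγ, hL, fun _ => rfl⟩⟩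

variable (F N) in
/-- **The residual type is inhabited** (v1.1; DEGENERATE inhabitant — step `0`, empty (1.89) regions on the coarsest lattice with one-point carriers, an 𝐑′-datum with NO
large-field regions, a Proposition-1 carrier with NO instances; NOT objects of record): so the W pin does not touch the inhabitation of the record class, which stays
`IsRecordOfRecord₁₀C`'s (`exists_world_isRecordOfRecord₁₀CB10YZW` + the rebind above). [cite: Balaban1989LargeFieldI, Prop. 1 p.194, (1.89) p.198, (1.100) p.201 (bookkeeping: the residual data type)] -/
theorem nonempty_residW : Nonempty (ResidW F N) :=
  ⟨{ kSel := fun _ => 0, P₀ := fun _ => F.P 0, Cfg := fun _ => PUnit, ι := fun _ => PUnit,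
     LF := fun _ => ⟨PEmpty, fun i => i.elim, fun i => i.elim, fun i => i.elim, fun i => i.elim, fun i => i.elim, fun i => i.elim, fun i => i.elim,
       fun i => i.elim⟩,
     D189 := fun _ => ⟨fun _ => ∅, fun _ => ∅, ∅, 0, 0, 0, 0, 0, 0, 0, fun _ => 0, 0, 0, 0, 0, 0, 0, fun _ => 0, fun _ => True, fun _ => True, fun _ => True,
       fun _ => ∅, ∅, fun _ _ => 1, fun _ => PUnit.unit, ∅, fun _ _ => 1, fun _ => 1, fun _ _ => 0, fun _ _ => 0, fun _ _ => 0⟩,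
     D1100 := fun _ =>
       { ZK := PEmpty, TT := fun z => z.elim, fintypeTT := fun z => z.elim, ttOp := fun z => z.elim, Fam := fun z => z.elim, fintypeFam := fun z => z.elim,
         fam := fun z => z.elim, expA := fun z => z.elim } }⟩

end Record10

end Literature.MathematicalPhysics.QuantumFieldTheory.Balaban1983to89.Node00

end
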